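import Literature.ModelTheory.ExponentialFields.LastRootConjectureProofs
import Literature.ModelTheory.ExponentialFields.NewtonExpSystems
import HarnessLib

/-!
# Partial derivatives of exponential polynomials computed on their monomial codes

Family `periods` (periods.S27), topic `Literature/ModelTheory/ExponentialFields`: support for the
Newton sentences of *flat* systems (integer exponential polynomials presented by monomial lists,
`Literature.ModelTheory.ExponentialFields.ExpPolyCode` of `LastRootConjecture.lean`) in the
decomposition of the conditional half of Macintyre–Wilkie's theorem.  Macintyre–Wilkie's /
Jones–Servi's Newton statement involves the Jacobian `JF` and a priori bounds on second
derivatives (Jones–Servi 2011, proof of Lemma 3.5: "`|F'(x̄)|, |F''(x̄)|, max |c_{ij}(x̄)|,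
max |∂JF/∂xᵢ(x̄)| < θ₀`"); for exponential polynomials over `ℤ` these derivatives are again
exponential polynomials over `ℤ`, obtained by the usual rules **on the codes**:
`∂ₖ (c · x̄^α · e^{β·x̄}) = c αₖ x̄^{α − eₖ} e^{β·x̄} + c βₖ x̄^α e^{β·x̄}`.  Writing the Newton sentences
with these (rather than with formal derivatives of terms, `RealExpModel.termPDeriv`) keeps their
Gödel numbers computable functions of the codes by list manipulations alone.

## Contents (all proved)

* `ExpPolyCode.setExp`, `ExpPolyCode.pdMono`, `ExpPolyCode.pdCode n k p` — the code of `∂p/∂xₖ`;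
  `eval_append`;
* `ExpPolyCode.hasDerivAt_eval_update`, `ExpPolyCode.fderiv_eval_single` — **in `ℝ`, the code
  derivative evaluates to the partial derivative**: `D(eval p)(x)(eₖ) = eval (pdCode n k p) x`;
* `ExpPolyCode.pdRowTerm n F i j`, `ExpPolyCode.pd2RowTerm n F i j k` — the terms of the first and
  second code derivatives of the rows of a system, and the identifications required by
  `NewtonExp.exists_zero_of_newtonHyp_of_terms` / `NewtonExp.real_models_newtonSentence`:
  `ExpPolyCode.jacFun_rowTerm_eq` (`hG`) and `ExpPolyCode.fderiv_pdRowTerm_single` (`hH`).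

## References

* G. O. Jones, T. Servi, *On the decidability of the real field with a generic power function*,
  J. Symb. Log. 76 (2011), Lemma 3.5 (proof).
* A. Macintyre, A. J. Wilkie, *On the decidability of the real exponential field* (1996), §4.
-/

noncomputable section

open FirstOrder FirstOrder.Language
open scoped BigOperators

namespace Literature.ModelTheory.ExponentialFields

namespace ExpPolyCode

/-! ### Code-level partial derivatives -/

/-- the exponent list `e` with position `k` set to `v` (normalised to length `max |e| (k+1)`,
missing exponents being `0`) [folklore] -/
def setExp (e : List ℕ) (k v : ℕ) : List ℕ :=
  (List.range (max e.length (k + 1))).map fun i => if i = k then v else e.getD i 0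

/-- Reading exponents off `setExp`. [folklore] -/
theorem getD_setExp (e : List ℕ) (k v i : ℕ) :
    (setExp e k v).getD i 0 = if i = k then v else e.getD i 0 := by
  unfold setExp
  rw [List.getD_eq_getElem?_getD, List.getElem?_map]
  by_cases hi : i < max e.length (k + 1)
  · rw [List.getElem?_range hi]
    simp
  · rw [List.getElem?_eq_none (by simpa using not_lt.1 hi)]
    have hik : i ≠ k := fun h => hi (by rw [h]; exact lt_max_of_lt_right (Nat.lt_succ_self k))
    have hie : e.length ≤ i := le_trans (le_max_left _ _) (not_lt.1 hi)
    simp [hik, List.getD_eq_getElem?_getD, List.getElem?_eq_none hie]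

/-- the code of the partial derivative `∂/∂xₖ` of a monomial `c · x̄^α e^{β·x̄}` (`α = e[0..n)`,
`β = e[n..2n)`): `c αₖ x̄^{α−eₖ} e^{β·x̄} + c βₖ x̄^α e^{β·x̄}` [folklore] -/
def pdMono (n k : ℕ) (m : ℤ × List ℕ) : ExpPolyCode :=
  [(m.1 * m.2.getD k 0, setExp m.2 k (m.2.getD k 0 - 1)), (m.1 * m.2.getD (n + k) 0, m.2)]

/-- **the code of `∂p/∂xₖ`** [folklore] -/
def pdCode (n k : ℕ) : ExpPolyCode → ExpPolyCode
  | [] => []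
  | m :: p => pdMono n k m ++ pdCode n k p

/-- `eval` is additive over concatenation of codes. [folklore] -/
theorem eval_append (n : ℕ) (x : Fin n → ℝ) :
    ∀ p q : ExpPolyCode, eval n (p ++ q) x = eval n p x + eval n q x
  | [], q => by simp
  | m :: p, q => by rw [List.cons_append, eval_cons, eval_cons, eval_append n x p q, add_assoc]

/-- `b · e^{b-1} · e = b · e^b` for natural `b` (both sides vanish for `b = 0`). [folklore] -/
theorem natCast_mul_pow_pred_mul (b : ℕ) (t : ℝ) : (b : ℝ) * t ^ (b - 1) * t = b * t ^ b := by
  rcases Nat.eq_zero_or_pos b with rfl | hb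
  · simp
  · rw [mul_assoc, ← pow_succ, Nat.sub_add_cancel hb]

/-- **Derivative of a monomial along the `k`-th coordinate**: it is the value of its code
derivative. [folklore] -/
theorem hasDerivAt_monomialEval_update {n : ℕ} (k : Fin n) (m : ℤ × List ℕ) (x : Fin n → ℝ) :
    HasDerivAt (fun s : ℝ => monomialEval n m (Function.update x k s))
      (eval n (pdMono n k m) x) (x k) := by
  classical
  obtain ⟨c, e⟩ := m
  set a : ℕ := e.getD (k : ℕ) 0 with ha
  set b : ℕ := e.getD (n + (k : ℕ)) 0 with hb
  -- the factor of the other coordinates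
  set R : ℝ := ∏ i ∈ Finset.univ.erase k, x i ^ e.getD (i : ℕ) 0 * Real.exp (x i) ^ e.getD (n + (i : ℕ)) 0
    with hR
  have hsplit : ∀ s : ℝ, monomialEval n (c, e) (Function.update x k s) =
      (c : ℝ) * ((s ^ a * Real.exp s ^ b) * R) := by
    intro s
    rw [monomialEval, ← Finset.mul_prod_erase _ _ (Finset.mem_univ k)]
    congr 2
    · simp [ha, hb]
    · refine Finset.prod_congr rfl fun i hi => ?_
      rw [Function.update_of_ne (Finset.ne_of_mem_erase hi)]
  have hfun : (fun s : ℝ => monomialEval n (c, e) (Function.update x k s)) =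
      fun s => (c : ℝ) * ((s ^ a * Real.exp s ^ b) * R) := funext hsplit
  rw [hfun]
  -- the one-variable derivative
  have h1 : HasDerivAt (fun s : ℝ => s ^ a * Real.exp s ^ b)
      ((a : ℝ) * x k ^ (a - 1) * Real.exp (x k) ^ b + x k ^ a * ((b : ℝ) * Real.exp (x k) ^ (b - 1) * Real.exp (x k)))
      (x k) := by
    have hp : HasDerivAt (fun s : ℝ => s ^ a) ((a : ℝ) * x k ^ (a - 1)) (x k) := hasDerivAt_pow a (x k)
    have he : HasDerivAt (fun s : ℝ => Real.exp s ^ b) ((b : ℝ) * Real.exp (x k) ^ (b - 1) * Real.exp (x k)) (x k) :=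
      (Real.hasDerivAt_exp (x k)).pow b
    exact hp.mul he
  have h2 := (h1.mul_const R).const_mul (c : ℝ)
  -- identify the value of the code derivative
  have hk1 : ∀ i : Fin n, (n + (i : ℕ)) ≠ (k : ℕ) := fun i h => by
    have := k.is_lt; omega
  have hval : eval n (pdMono n k (c, e)) x =
      (c : ℝ) * (((a : ℝ) * x k ^ (a - 1) * Real.exp (x k) ^ b +
          x k ^ a * ((b : ℝ) * Real.exp (x k) ^ (b - 1) * Real.exp (x k))) * R) := by
    unfold pdMono
    simp only [eval_cons, eval_nil, add_zero]
    rw [monomialEval, monomialEval, ← Finset.mul_prod_erase _ _ (Finset.mem_univ k),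
      ← Finset.mul_prod_erase Finset.univ
        (fun i => x i ^ e.getD (i : ℕ) 0 * Real.exp (x i) ^ e.getD (n + (i : ℕ)) 0) (Finset.mem_univ k)]
    have hR' : (∏ i ∈ Finset.univ.erase k, x i ^ (setExp e k (e.getD (k : ℕ) 0 - 1)).getD (i : ℕ) 0 *
        Real.exp (x i) ^ (setExp e k (e.getD (k : ℕ) 0 - 1)).getD (n + (i : ℕ)) 0) = R := by
      refine Finset.prod_congr rfl fun i hi => ?_
      have hik : (i : ℕ) ≠ (k : ℕ) := fun h => Finset.ne_of_mem_erase hi (Fin.ext h)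
      rw [getD_setExp, getD_setExp, if_neg hik, if_neg (hk1 i)]
    rw [hR', getD_setExp, getD_setExp, if_pos rfl, if_neg (hk1 k), ← ha, ← hb, ← hR]
    push_cast
    have := natCast_mul_pow_pred_mul b (Real.exp (x k))
    calc ((c : ℝ) * (a : ℝ)) * (x k ^ (a - 1) * Real.exp (x k) ^ b * R) +
          ((c : ℝ) * (b : ℝ)) * (x k ^ a * Real.exp (x k) ^ b * R)
        = (c : ℝ) * (((a : ℝ) * x k ^ (a - 1) * Real.exp (x k) ^ b +
            x k ^ a * ((b : ℝ) * Real.exp (x k) ^ b)) * R) := by ring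
      _ = (c : ℝ) * (((a : ℝ) * x k ^ (a - 1) * Real.exp (x k) ^ b +
            x k ^ a * ((b : ℝ) * Real.exp (x k) ^ (b - 1) * Real.exp (x k))) * R) := by rw [this]
  rw [hval]
  exact h2

/-- **Derivative of an exponential polynomial along the `k`-th coordinate** is the value of its
code derivative. [folklore] -/
theorem hasDerivAt_eval_update {n : ℕ} (k : Fin n) (x : Fin n → ℝ) :
    ∀ p : ExpPolyCode, HasDerivAt (fun s : ℝ => eval n p (Function.update x k s))
      (eval n (pdCode n k p) x) (x k)
  | [] => by simpa [pdCode] using hasDerivAt_const (x k) (0 : ℝ)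
  | m :: p => by
    have h := (hasDerivAt_monomialEval_update k m x).add (hasDerivAt_eval_update k x p)
    rw [pdCode, eval_append]
    exact h.congr_of_eventuallyEq (Filter.Eventually.of_forall fun s => by simp)

/-- **In `ℝ`, the code derivative is the partial derivative**: the Fréchet derivative of
`eval n p` on the `k`-th coordinate vector is `eval n (pdCode n k p)`. [folklore] -/
theorem fderiv_eval_single {n : ℕ} (p : ExpPolyCode) (x : Fin n → ℝ) (k : Fin n) :
    fderiv ℝ (eval n p) x (Pi.single k 1) = eval n (pdCode n k p) x := by
  have hd : DifferentiableAt ℝ (eval n p) x := ((contDiff_eval n p).differentiable (by simp)) x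
  have h1 : HasDerivAt (fun s : ℝ => eval n p (Function.update x k s))
      (fderiv ℝ (eval n p) x (Pi.single k 1)) (x k) := by
    have hf : HasFDerivAt (eval n p) (fderiv ℝ (eval n p) x) (Function.update x k (x k)) := by
      rw [Function.update_eq_self]
      exact hd.hasFDerivAt
    exact hf.comp_hasDerivAt (x k) (hasDerivAt_update x k (x k))
  exact h1.unique (hasDerivAt_eval_update k x p)

/-! ### The derivative rows as terms -/

section Rows

variable (n : ℕ) (F : List ExpPolyCode)

/-- the term of `∂ⱼ` of row `i` (code derivative) in the coordinate variables [folklore] -/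
def pdRowTerm (i j : Fin n) : Language.orderedExpRing.Term (Empty ⊕ Fin n) :=
  evalTermX n (fun l => var (Sum.inr l)) (pdCode n j (F.getD (i : ℕ) []))

/-- the term of `∂ₖ ∂ⱼ` of row `i` (iterated code derivative) [folklore] -/
def pd2RowTerm (i j k : Fin n) : Language.orderedExpRing.Term (Empty ⊕ Fin n) :=
  evalTermX n (fun l => var (Sum.inr l)) (pdCode n k (pdCode n j (F.getD (i : ℕ) [])))

/-- The derivative-row terms realize to the values of the code derivatives. [folklore] -/
@[simp] theorem realize_pdRowTerm (x : Fin n → ℝ) (i j : Fin n) :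
    (pdRowTerm n F i j).realize (Sum.elim Empty.elim x) = eval n (pdCode n j (F.getD (i : ℕ) [])) x := by
  simp [pdRowTerm]

/-- The second-derivative-row terms realize to the values of the iterated code derivatives. [folklore] -/
@[simp] theorem realize_pd2RowTerm (x : Fin n → ℝ) (i j k : Fin n) :
    (pd2RowTerm n F i j k).realize (Sum.elim Empty.elim x) =
      eval n (pdCode n k (pdCode n j (F.getD (i : ℕ) []))) x := by
  simp [pd2RowTerm]

/-- **`hG` for codes**: the Jacobian of the row system (formal derivatives, `NewtonExp.jacFun`)
is realized by the code-derivative rows. [folklore] -/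
theorem jacFun_rowTerm_eq (x : Fin n → ℝ) (i j : Fin n) :
    NewtonExp.jacFun (fun i => rowTerm n F i) x i j = (pdRowTerm n F i j).realize (Sum.elim Empty.elim x) := by
  have h1 : NewtonExp.jacFun (fun i => rowTerm n F i) x i j =
      (RealExpModel.termPDeriv j (rowTerm n F i)).realize (Sum.elim Empty.elim x) := rfl
  rw [h1, ← RealExpModel.fderiv_realize_single, realize_pdRowTerm]
  have : (fun x : Fin n → ℝ => (rowTerm n F i).realize (Sum.elim Empty.elim x)) = eval n (F.getD (i : ℕ) []) :=
    funext fun x => realize_rowTerm n F Empty.elim x i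
  rw [this, fderiv_eval_single]

/-- **`hH` for codes**: the partial derivatives of the code-derivative rows are realized by the
iterated code-derivative rows. [folklore] -/
theorem fderiv_pdRowTerm_single (x : Fin n → ℝ) (i j k : Fin n) :
    fderiv ℝ (fun x : Fin n → ℝ => (pdRowTerm n F i j).realize (Sum.elim Empty.elim x)) x (Pi.single k 1) =
      (pd2RowTerm n F i j k).realize (Sum.elim Empty.elim x) := by
  have : (fun x : Fin n → ℝ => (pdRowTerm n F i j).realize (Sum.elim Empty.elim x)) =
      eval n (pdCode n j (F.getD (i : ℕ) [])) := funext fun x => realize_pdRowTerm n F x i j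
  rw [this, fderiv_eval_single, realize_pd2RowTerm]

end Rows

end ExpPolyCode

end Literature.ModelTheory.ExponentialFields

end
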